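import Literature.Topology.CoveringSpaces.CoveringIdRigid
import Literature.AnabelianGeometry.AbsoluteAnabelian.SlimOfEquivalence
import Literature.AnabelianGeometry.Anabelioids.SlimProofs
import HarnessLib

/-!
# `Cov^fin(X)` is a SLIM anabelioid iff `π̂₁(X, x₀)` is a slim profinite group

PROOF-ONLY companion (abc-iut cell, campaign-L R1 support, GAP row G-L4t14-R1; seat abc-iut-f-072).
[AbsTopIII] Lemma 4.3 p. 106 («Slimness of Archimedean Fundamental Groups … `Π_X` is slim») is consumed by
Prop. 4.2 (i) through [GeoAn] Def. 1.2.4 / [SemiAnbd] §0 p. 6 («`B(G)` is slim iff `Z_G(H) = 1` for every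
open `H`» — the tree's `bCat_isSlim_iff_isSlimGroup_holds`).  At the topological level, with abc-iut-w5-d144's
`CovFin.equivBCat x₀ : CovFin X ≌ B(π̂₁(X, x₀))` and slimness being invariant under equivalence
(`isSlim_iff_of_equivalence`):

* `CovFin.isSlim_iff_isSlim_bCat` — `Cov^fin(X)` is slim (every `Cov^fin(X)_{/E} → Cov^fin(X)` rigid) iff
  `B(π̂₁(X, x₀))` is slim (universe-polymorphic);
* `CovFin.isSlim_iff_isSlimGroup` — iff the profinite completion `π̂₁(X, x₀)` is a SLIM group (`X : Type`);
* `CovFin.isSlim_compl_finite` — `Cov^fin(ℂ ∖ F)` is a slim category for `F` finite, `2 ≤ |F|` (the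
  thrice-punctured sphere), `π₁ ≅ F_{|F|}` having slim profinite completion (w5-d144 / w5-d016 ingredients).

Theorems only; nothing here bears on [IUTchIII] Cor. 3.12.
-/

noncomputable section

open CategoryTheory

universe u

namespace Literature.Topology.CoveringSpaces.CovFin

open Literature.AnabelianGeometry.AbsoluteAnabelian Literature.AnabelianGeometry.Anabelioids
open Literature.AlgebraicGeometry.Frobenioids Literature.IUT.HodgeTheaters

/-- **`Cov^fin(X)` is slim iff `B(π̂₁(X, x₀))` is slim** (universe-polymorphic form).
[cite: MochizukiFrdI2008, §0 p.14] -/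
theorem isSlim_iff_isSlim_bCat {X : Type u} [TopologicalSpace X] [PathConnectedSpace X]
    [StronglyLocallyContractibleSpace X] (x₀ : X) :
    IsSlim (CovFin X) ↔ IsSlim (BCat (profiniteCompletion (FundamentalGroup X x₀))) :=
  isSlim_iff_of_equivalence (equivBCat (X := X) x₀)

/-- **`Cov^fin(X)` is a slim anabelioid iff `π̂₁(X, x₀)` is a slim profinite group** — the categorical
reading of [AbsTopIII] Lemma 4.3 at the topological level ([SemiAnbd] §0: `B(G)` slim iff `G` slim).
[cite: MochizukiAbsTopIII2015, Lemma 4.3 p.106] -/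
theorem isSlim_iff_isSlimGroup {X : Type} [TopologicalSpace X] [PathConnectedSpace X]
    [StronglyLocallyContractibleSpace X] (x₀ : X) :
    IsSlim (CovFin X) ↔ IsSlimGroup (profiniteCompletion (FundamentalGroup X x₀)) :=
  (isSlim_iff_isSlim_bCat x₀).trans (bCat_isSlim_iff_isSlimGroup_holds _)

/-- **`Cov^fin(ℂ ∖ F)` is slim** for `F ⊆ ℂ` finite with at least two points (e.g. the thrice-punctured
sphere `ℂ ∖ {0, 1}`): `π₁(ℂ ∖ F) ≅ F_{|F|}` has slim profinite completion
(`isSlimGroup_profiniteCompletion_fundamentalGroup_compl_finite`). [cite: MochizukiAbsTopIII2015, Lemma 4.3 p.106] -/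
theorem isSlim_compl_finite {F : Set ℂ} (hF : F.Finite) (h2 : 2 ≤ F.ncard) : IsSlim (CovFin ↥(Fᶜ)) := by
  haveI := pathConnectedSpace_compl_finite hF
  haveI := stronglyLocallyContractibleSpace_compl_finite hF
  have x : ↥(Fᶜ) := Classical.arbitrary _
  exact (isSlim_iff_isSlimGroup x).mpr (isSlimGroup_profiniteCompletion_fundamentalGroup_compl_finite hF h2 x)

end Literature.Topology.CoveringSpaces.CovFin
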